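import Summits.AnomalousDissipation.AnomalousDissipation.Theorems.MomentParityPathSpace

/-!
# Route MomentParity · `GalerkinEnsembleRealization` — the continuous-time extension of a path

For a path `ω` of the trajectory space `pathSpace R L` (`MomentParityDefs`), the value
`pathExt ω t k` at a real time `t ≥ 0` is the limit of `ω` along any sequence of nonnegative
rational times tending to `t` (Lipschitz clause); it extends `ω`, is `L k`-Lipschitz in `t`,
continuous in `ω ∈ 𝒦` (uniformly approximated by coordinates), keeps the energy bound, reality and
transversality, and intertwines the shift: `(θω)‾(t) = ω̄(t + 1)` (stmt-AnomalousDissipation-11466).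
-/

noncomputable section

set_option linter.dupNamespace false

open MeasureTheory Set Filter Topology Function Metric
open scoped BigOperators

namespace Summit.AnomalousDissipation.AnomalousDissipation.Theorems.MomentParity

open Literature.Analysis.FunctionSpaces Literature.Analysis.FunctionSpaces.Torus Literature.Analysis.FluidPDE

variable {d : Type*} [Fintype d] {R : ℝ} {L : (d → ℤ) → ℝ}

/-! ### Dyadic approximations -/

/-- `2⁻ⁿ → 0`. -/
theorem tendsto_inv_two_pow : Tendsto (fun n : ℕ => ((2 : ℝ) ^ n)⁻¹) atTop (𝓝 0) := by
  rw [show (fun n : ℕ => ((2 : ℝ) ^ n)⁻¹) = fun n => ((2 : ℝ)⁻¹) ^ n from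
    funext fun n => (inv_pow 2 n).symm]
  exact tendsto_pow_atTop_nhds_zero_of_lt_one (by norm_num) (by norm_num)

/-- `2⁻ⁿ` is antitone. -/
theorem inv_two_pow_anti {n m : ℕ} (h : n ≤ m) : ((2 : ℝ) ^ m)⁻¹ ≤ ((2 : ℝ) ^ n)⁻¹ :=
  inv_anti₀ (by positivity) (pow_le_pow_right₀ one_le_two h)

/-- `⌊t⁺2ⁿ⌋/2ⁿ ≤ t⁺`. -/
theorem dyadicFloor_le (t : ℝ) (n : ℕ) : (dyadicFloor t n : ℝ) ≤ max t 0 := by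
  rw [dyadicFloor, Rat.cast_div, Rat.cast_intCast, Rat.cast_pow, Rat.cast_ofNat,
    div_le_iff₀ (by positivity)]
  exact Int.floor_le _

/-- `t⁺ < ⌊t⁺2ⁿ⌋/2ⁿ + 2⁻ⁿ`. -/
theorem lt_dyadicFloor_add (t : ℝ) (n : ℕ) : max t 0 < (dyadicFloor t n : ℝ) + (2 ^ n)⁻¹ := by
  rw [dyadicFloor, Rat.cast_div, Rat.cast_intCast, Rat.cast_pow, Rat.cast_ofNat]
  have h := Int.lt_floor_add_one (max t 0 * 2 ^ n)
  have h2 : (0 : ℝ) < 2 ^ n := by positivity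
  calc max t 0 = (max t 0 * 2 ^ n) / 2 ^ n := by field_simp
    _ < (⌊max t 0 * 2 ^ n⌋ + 1 : ℝ) / 2 ^ n := by gcongr
    _ = _ := by ring

/-- The dyadic approximations are nonnegative. -/
theorem dyadicFloor_nonneg (t : ℝ) (n : ℕ) : 0 ≤ dyadicFloor t n := by
  rw [dyadicFloor]
  refine div_nonneg ?_ (by positivity)
  exact_mod_cast Int.floor_nonneg.2 (by positivity : (0 : ℝ) ≤ max t 0 * 2 ^ n)

/-- `|t⁺ - ⌊t⁺2ⁿ⌋/2ⁿ| ≤ 2⁻ⁿ`. -/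
theorem abs_sub_dyadicFloor_le (t : ℝ) (n : ℕ) : |max t 0 - (dyadicFloor t n : ℝ)| ≤ (2 ^ n)⁻¹ := by
  rw [abs_of_nonneg (sub_nonneg.2 (dyadicFloor_le t n))]
  linarith [lt_dyadicFloor_add t n]

/-- The dyadic approximations converge to `t⁺`. -/
theorem tendsto_dyadicFloor (t : ℝ) : Tendsto (fun n => (dyadicFloor t n : ℝ)) atTop (𝓝 (max t 0)) := by
  have h : Tendsto (fun n : ℕ => ((2 : ℝ) ^ n)⁻¹) atTop (𝓝 0) := tendsto_inv_two_pow
  refine tendsto_of_tendsto_of_tendsto_of_le_of_le (g := fun n => max t 0 - ((2 : ℝ) ^ n)⁻¹)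
    (h := fun _ => max t 0) ?_ tendsto_const_nhds (fun n => ?_) (fun n => dyadicFloor_le t n)
  · simpa using tendsto_const_nhds.sub h
  · linarith [lt_dyadicFloor_add t n]

/-! ### The extension along rational sequences -/

/-- **The extension is the limit of `ω` along every sequence of nonnegative rational times tending
to `t⁺`** (for `ω ∈ 𝒦(R, L)`): along the dyadic approximations by definition (a Cauchy sequence by
the Lipschitz clause), and along any other such sequence by the Lipschitz clause again. -/
theorem tendsto_apply_of_tendsto {ω : Path d} (hω : ω ∈ pathSpace R L) (t : ℝ) (k : d → ℤ)
    {r : ℕ → ℚ} (hr0 : ∀ n, 0 ≤ r n) (hr : Tendsto (fun n => (r n : ℝ)) atTop (𝓝 (max t 0))) :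
    Tendsto (fun n => ω (r n, k)) atTop (𝓝 (pathExt ω t k)) := by
  have hLip := hω.2.2.1
  have hL0 : 0 ≤ L k := by
    have h := hLip 0 1 k le_rfl zero_le_one
    have h1 : (0 : ℝ) < |((0 : ℚ) : ℝ) - (1 : ℚ)| := by norm_num
    nlinarith [norm_nonneg (ω (0, k) - ω (1, k))]
  -- the dyadic sequence is Cauchy
  have hcauchy : CauchySeq fun n => ω (dyadicFloor t n, k) := by
    refine Metric.cauchySeq_iff'.2 fun ε hε => ?_
    obtain ⟨N, hN⟩ : ∃ N : ℕ, (L k + 1) * ((2 : ℝ) ^ N)⁻¹ < ε := by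
      have h : Tendsto (fun n : ℕ => (L k + 1) * ((2 : ℝ) ^ n)⁻¹) atTop (𝓝 0) := by
        simpa using tendsto_inv_two_pow.const_mul (L k + 1)
      exact (h.eventually (gt_mem_nhds hε)).exists
    refine ⟨N, fun n hn => ?_⟩
    rw [dist_eq_norm]
    have h1 := hLip (dyadicFloor t n) (dyadicFloor t N) k (dyadicFloor_nonneg t n) (dyadicFloor_nonneg t N)
    have h2 : |(dyadicFloor t n : ℝ) - dyadicFloor t N| ≤ ((2 : ℝ) ^ N)⁻¹ := by
      rw [abs_sub_le_iff]
      have a1 := dyadicFloor_le t n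
      have a2 := lt_dyadicFloor_add t n
      have b1 := dyadicFloor_le t N
      have b2 := lt_dyadicFloor_add t N
      have hmono : ((2 : ℝ) ^ n)⁻¹ ≤ ((2 : ℝ) ^ N)⁻¹ := inv_two_pow_anti hn
      constructor <;> linarith
    calc ‖ω (dyadicFloor t n, k) - ω (dyadicFloor t N, k)‖ ≤ L k * |(dyadicFloor t n : ℝ) - dyadicFloor t N| := h1
      _ ≤ L k * ((2 : ℝ) ^ N)⁻¹ := mul_le_mul_of_nonneg_left h2 hL0
      _ < ε := by nlinarith [inv_nonneg.2 (pow_nonneg (zero_le_two (α := ℝ)) N)]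
  have hdy : Tendsto (fun n => ω (dyadicFloor t n, k)) atTop (𝓝 (pathExt ω t k)) :=
    tendsto_nhds_limUnder (cauchySeq_tendsto_of_complete hcauchy)
  -- comparison with the given sequence
  have hdiff : Tendsto (fun n => ω (r n, k) - ω (dyadicFloor t n, k)) atTop (𝓝 0) := by
    refine squeeze_zero_norm (fun n => hLip (r n) (dyadicFloor t n) k (hr0 n) (dyadicFloor_nonneg t n)) ?_
    have : Tendsto (fun n => L k * |(r n : ℝ) - dyadicFloor t n|) atTop (𝓝 (L k * |max t 0 - max t 0|)) :=
      ((hr.sub (tendsto_dyadicFloor t)).abs).const_mul _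
    simpa using this
  have := hdiff.add hdy
  simpa using this

/-- The defining dyadic sequence converges to the extension. -/
theorem tendsto_dyadic_apply {ω : Path d} (hω : ω ∈ pathSpace R L) (t : ℝ) (k : d → ℤ) :
    Tendsto (fun n => ω (dyadicFloor t n, k)) atTop (𝓝 (pathExt ω t k)) :=
  tendsto_apply_of_tendsto hω t k (dyadicFloor_nonneg t) (tendsto_dyadicFloor t)

/-- **The extension extends**: at a nonnegative rational time it is the value of the path. -/
theorem pathExt_ratCast {ω : Path d} (hω : ω ∈ pathSpace R L) {q : ℚ} (hq : 0 ≤ q) (k : d → ℤ) :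
    pathExt ω q k = ω (q, k) := by
  have h := tendsto_apply_of_tendsto hω (q : ℝ) k (r := fun _ => q) (fun _ => hq)
    (by rw [max_eq_left (by exact_mod_cast hq)]; exact tendsto_const_nhds)
  exact tendsto_nhds_unique h tendsto_const_nhds

/-- Negative times carry the value at `0`: `ω̄(t) = ω̄(t⁺)`. -/
theorem pathExt_eq_pathExt_max (ω : Path d) (t : ℝ) (k : d → ℤ) :
    pathExt ω t k = pathExt ω (max t 0) k := by
  simp only [pathExt, dyadicFloor, max_eq_left (le_max_right t 0)]

/-- **Rate of approximation** by the dyadic sequence: `‖ω̄(t,k) - ω(⌊t⁺2ⁿ⌋/2ⁿ, k)‖ ≤ L k / 2ⁿ`. -/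
theorem norm_pathExt_sub_dyadic_le {ω : Path d} (hω : ω ∈ pathSpace R L) (t : ℝ) (k : d → ℤ) (n : ℕ) :
    ‖pathExt ω t k - ω (dyadicFloor t n, k)‖ ≤ L k * ((2 : ℝ) ^ n)⁻¹ := by
  have hLip := hω.2.2.1
  have hlim : Tendsto (fun m => ‖ω (dyadicFloor t m, k) - ω (dyadicFloor t n, k)‖) atTop
      (𝓝 ‖pathExt ω t k - ω (dyadicFloor t n, k)‖) :=
    ((tendsto_dyadic_apply hω t k).sub tendsto_const_nhds).norm
  refine le_of_tendsto hlim (eventually_atTop.2 ⟨n, fun m hm => ?_⟩)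
  refine (hLip _ _ k (dyadicFloor_nonneg t m) (dyadicFloor_nonneg t n)).trans ?_
  have hL0 : 0 ≤ L k := by
    have h := hLip 0 1 k le_rfl zero_le_one
    have h1 : (0 : ℝ) < |((0 : ℚ) : ℝ) - (1 : ℚ)| := by norm_num
    nlinarith [norm_nonneg (ω (0, k) - ω (1, k))]
  refine mul_le_mul_of_nonneg_left ?_ hL0
  rw [abs_sub_le_iff]
  have a1 := dyadicFloor_le t m
  have a2 := lt_dyadicFloor_add t m
  have b1 := dyadicFloor_le t n
  have b2 := lt_dyadicFloor_add t n
  have hmono : ((2 : ℝ) ^ m)⁻¹ ≤ ((2 : ℝ) ^ n)⁻¹ := inv_two_pow_anti hm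
  constructor <;> linarith

/-- The Lipschitz constants of an inhabited trajectory space are nonnegative. -/
theorem pathLip_nonneg_of_mem {ω : Path d} (hω : ω ∈ pathSpace R L) (k : d → ℤ) : 0 ≤ L k := by
  have h := hω.2.2.1 0 1 k le_rfl zero_le_one
  have h1 : (0 : ℝ) < |((0 : ℚ) : ℝ) - (1 : ℚ)| := by norm_num
  nlinarith [norm_nonneg (ω (0, k) - ω (1, k))]

/-- **The extension is Lipschitz in time**: `‖ω̄(t,k) - ω̄(s,k)‖ ≤ L k |t - s|`. -/
theorem norm_pathExt_sub_le {ω : Path d} (hω : ω ∈ pathSpace R L) (t s : ℝ) (k : d → ℤ) :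
    ‖pathExt ω t k - pathExt ω s k‖ ≤ L k * |t - s| := by
  have hLip := hω.2.2.1
  have hlim : Tendsto (fun n => ‖ω (dyadicFloor t n, k) - ω (dyadicFloor s n, k)‖) atTop
      (𝓝 ‖pathExt ω t k - pathExt ω s k‖) :=
    ((tendsto_dyadic_apply hω t k).sub (tendsto_dyadic_apply hω s k)).norm
  have hlim2 : Tendsto (fun n => L k * |(dyadicFloor t n : ℝ) - dyadicFloor s n|) atTop
      (𝓝 (L k * |max t 0 - max s 0|)) :=
    (((tendsto_dyadicFloor t).sub (tendsto_dyadicFloor s)).abs).const_mul _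
  have h1 : ‖pathExt ω t k - pathExt ω s k‖ ≤ L k * |max t 0 - max s 0| :=
    le_of_tendsto_of_tendsto hlim hlim2 (Eventually.of_forall fun n =>
      hLip _ _ k (dyadicFloor_nonneg t n) (dyadicFloor_nonneg s n))
  refine h1.trans (mul_le_mul_of_nonneg_left (abs_max_sub_max_le_abs _ _ _) (pathLip_nonneg_of_mem hω k))

/-- The extension is continuous in time. -/
theorem continuous_pathExt_time {ω : Path d} (hω : ω ∈ pathSpace R L) (k : d → ℤ) :
    Continuous fun t => pathExt ω t k := by
  refine (LipschitzWith.of_dist_le_mul (K := (L k).toNNReal) fun t s => ?_).continuous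
  rw [dist_eq_norm, dist_eq_norm, Real.coe_toNNReal', Real.norm_eq_abs]
  exact (norm_pathExt_sub_le hω t s k).trans
    (mul_le_mul_of_nonneg_right (le_max_left _ _) (abs_nonneg _))

/-! ### Continuity in the path -/

/-- **The extension is continuous on the trajectory space**, jointly in the path and the time
(uniform approximation by the coordinates `ω ↦ ω(⌊t⁺2ⁿ⌋/2ⁿ, k)` and the uniform Lipschitz bound
in time). -/
theorem continuousOn_pathExt (R : ℝ) (L : (d → ℤ) → ℝ) (k : d → ℤ) :
    ContinuousOn (fun p : Path d × ℝ => pathExt p.1 p.2 k) (pathSpace R L ×ˢ univ) := by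
  rintro ⟨ω₀, t₀⟩ ⟨hω₀, -⟩
  rw [ContinuousWithinAt, Metric.tendsto_nhds]
  intro ε hε
  have hL0 := pathLip_nonneg_of_mem hω₀ k
  -- choose the dyadic scale
  obtain ⟨n, hn⟩ : ∃ n : ℕ, (L k + 1) * ((2 : ℝ) ^ n)⁻¹ < ε / 4 := by
    have h : Tendsto (fun n : ℕ => (L k + 1) * ((2 : ℝ) ^ n)⁻¹) atTop (𝓝 0) := by
      simpa using tendsto_inv_two_pow.const_mul (L k + 1)
    exact (h.eventually (gt_mem_nhds (by positivity))).exists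
  have hpow : 0 ≤ ((2 : ℝ) ^ n)⁻¹ := by positivity
  -- neighbourhood: the coordinate at `(q_n(t₀), k)` is close, and `t` is close to `t₀`
  have h1 : ∀ᶠ p : Path d × ℝ in 𝓝[pathSpace R L ×ˢ univ] (ω₀, t₀),
      dist (p.1 (dyadicFloor t₀ n, k)) (ω₀ (dyadicFloor t₀ n, k)) < ε / 4 := by
    have hc : Continuous fun p : Path d × ℝ => p.1 (dyadicFloor t₀ n, k) :=
      (continuous_apply _).comp continuous_fst
    exact (Metric.tendsto_nhds.1 (hc.tendsto (ω₀, t₀)) (ε / 4) (by positivity)).filter_mono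
      nhdsWithin_le_nhds
  have h2 : ∀ᶠ p : Path d × ℝ in 𝓝[pathSpace R L ×ˢ univ] (ω₀, t₀), (L k + 1) * |p.2 - t₀| < ε / 4 := by
    have hc : Continuous fun p : Path d × ℝ => (L k + 1) * |p.2 - t₀| :=
      continuous_const.mul ((continuous_snd.sub continuous_const).abs)
    have h0 : (fun p : Path d × ℝ => (L k + 1) * |p.2 - t₀|) (ω₀, t₀) < ε / 4 := by
      simp only [sub_self, abs_zero, mul_zero]; positivity
    exact (hc.continuousAt.eventually (gt_mem_nhds h0)).filter_mono nhdsWithin_le_nhds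
  have h3 : ∀ᶠ p : Path d × ℝ in 𝓝[pathSpace R L ×ˢ univ] (ω₀, t₀), p.1 ∈ pathSpace R L := by
    filter_upwards [self_mem_nhdsWithin] with p hp using hp.1
  filter_upwards [h1, h2, h3] with p hp1 hp2 hp3
  obtain ⟨ω, t⟩ := p
  simp only at hp1 hp2 hp3 ⊢
  rw [dist_eq_norm] at hp1 ⊢
  -- `ω̄(t) - ω̄₀(t₀) = (ω̄(t) - ω̄(t₀)) + (ω̄(t₀) - ω(qₙ)) + (ω(qₙ) - ω₀(qₙ)) + (ω₀(qₙ) - ω̄₀(t₀))`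
  have e1 := norm_pathExt_sub_le hp3 t t₀ k
  have e2 := norm_pathExt_sub_dyadic_le hp3 t₀ k n
  have e4 := norm_pathExt_sub_dyadic_le hω₀ t₀ k n
  have hLk : L k * ((2 : ℝ) ^ n)⁻¹ ≤ (L k + 1) * ((2 : ℝ) ^ n)⁻¹ := by nlinarith
  have hLt : L k * |t - t₀| ≤ (L k + 1) * |t - t₀| := by nlinarith [abs_nonneg (t - t₀)]
  have tri : ∀ a b c e : EuclideanSpace ℂ d, ‖a + b + c - e‖ ≤ ‖a‖ + ‖b‖ + ‖c‖ + ‖e‖ := by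
    intro a b c e
    have h3 := @norm_add₃_le _ _ a b c
    calc ‖a + b + c - e‖ ≤ ‖a + b + c‖ + ‖e‖ := norm_sub_le _ _
      _ ≤ ‖a‖ + ‖b‖ + ‖c‖ + ‖e‖ := by linarith
  calc ‖pathExt ω t k - pathExt ω₀ t₀ k‖
      = ‖(pathExt ω t k - pathExt ω t₀ k) + (pathExt ω t₀ k - ω (dyadicFloor t₀ n, k)) +
          (ω (dyadicFloor t₀ n, k) - ω₀ (dyadicFloor t₀ n, k)) -
          (pathExt ω₀ t₀ k - ω₀ (dyadicFloor t₀ n, k))‖ := by congr 1; abel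
    _ ≤ ‖pathExt ω t k - pathExt ω t₀ k‖ + ‖pathExt ω t₀ k - ω (dyadicFloor t₀ n, k)‖ +
          ‖ω (dyadicFloor t₀ n, k) - ω₀ (dyadicFloor t₀ n, k)‖ +
          ‖pathExt ω₀ t₀ k - ω₀ (dyadicFloor t₀ n, k)‖ := tri _ _ _ _
    _ < ε / 4 + ε / 4 + ε / 4 + ε / 4 :=
        add_lt_add (add_lt_add (add_lt_add (lt_of_le_of_lt (e1.trans hLt) hp2)
          (lt_of_le_of_lt (e2.trans hLk) hn)) hp1) (lt_of_le_of_lt (e4.trans hLk) hn)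
    _ = ε := by ring

/-- The extension at a fixed time is continuous on the trajectory space (as a function on the
subtype). -/
theorem continuous_pathExt_subtype (R : ℝ) (L : (d → ℤ) → ℝ) (t : ℝ) (k : d → ℤ) :
    Continuous fun ω : ↥(pathSpace (d := d) R L) => pathExt ω.1 t k :=
  (continuousOn_pathExt R L k).comp_continuous (continuous_subtype_val.prodMk continuous_const)
    fun ω => ⟨ω.2, mem_univ _⟩

/-- The extension is jointly continuous on `𝒦 × ℝ`. -/
theorem continuous_pathExt_subtype_prod (R : ℝ) (L : (d → ℤ) → ℝ) (k : d → ℤ) :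
    Continuous fun p : ↥(pathSpace (d := d) R L) × ℝ => pathExt p.1.1 p.2 k :=
  (continuousOn_pathExt R L k).comp_continuous
    ((continuous_subtype_val.comp continuous_fst).prodMk continuous_snd) fun p => ⟨p.1.2, mem_univ _⟩

/-! ### Energy bound, reality, transversality -/

/-- **The energy bound passes to the extension**: `∑_{k∈T} ‖ω̄(t,k)‖² ≤ R²`. -/
theorem sum_norm_pathExt_sq_le {ω : Path d} (hω : ω ∈ pathSpace R L) (t : ℝ) (T : Finset (d → ℤ)) :
    ∑ k ∈ T, ‖pathExt ω t k‖ ^ 2 ≤ R ^ 2 := by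
  have hlim : Tendsto (fun n => ∑ k ∈ T, ‖ω (dyadicFloor t n, k)‖ ^ 2) atTop
      (𝓝 (∑ k ∈ T, ‖pathExt ω t k‖ ^ 2)) :=
    tendsto_finsetSum _ fun k _ => ((tendsto_dyadic_apply hω t k).norm).pow 2
  exact le_of_tendsto' hlim fun n => hω.2.1 _ T

/-- Every coefficient of the extension is bounded by `|R|`. -/
theorem norm_pathExt_le {ω : Path d} (hω : ω ∈ pathSpace R L) (t : ℝ) (k : d → ℤ) :
    ‖pathExt ω t k‖ ≤ |R| := by
  have h := sum_norm_pathExt_sq_le hω t {k}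
  rw [Finset.sum_singleton] at h
  have h' : ‖pathExt ω t k‖ ^ 2 ≤ |R| ^ 2 := by rwa [sq_abs]
  exact le_abs_self _ |>.trans (abs_le_of_sq_le_sq h' (abs_nonneg R))

/-- The squared coefficients of the extension are summable, with sum at most `R²`. -/
theorem summable_norm_pathExt_sq {ω : Path d} (hω : ω ∈ pathSpace R L) (t : ℝ) :
    Summable fun k => ‖pathExt ω t k‖ ^ 2 :=
  summable_of_sum_le (fun _ => sq_nonneg _) (sum_norm_pathExt_sq_le hω t)

/-- The total energy of the extension is at most `R²`. -/
theorem pathEnergyTot_le {ω : Path d} (hω : ω ∈ pathSpace R L) (t : ℝ) : pathEnergyTot ω t ≤ R ^ 2 :=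
  (summable_norm_pathExt_sq hω t).tsum_le_of_sum_le (sum_norm_pathExt_sq_le hω t)

/-- The total energy is nonnegative. -/
theorem pathEnergyTot_nonneg (ω : Path d) (t : ℝ) : 0 ≤ pathEnergyTot ω t :=
  tsum_nonneg fun _ => sq_nonneg _

/-- **Reality of the extension**: `ω̄(t, -k) = conj ω̄(t, k)`. -/
theorem isConjSymm_pathExt {ω : Path d} (hω : ω ∈ pathSpace R L) (t : ℝ) :
    IsConjSymm fun k => pathExt ω t k := by
  intro k
  have h1 := tendsto_dyadic_apply hω t (-k)
  have h2 : Tendsto (fun n => EuclideanSpace.conjVec (ω (dyadicFloor t n, k))) atTop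
      (𝓝 (EuclideanSpace.conjVec (pathExt ω t k))) :=
    ((EuclideanSpace.conjVecL (ι := d)).continuous.tendsto _).comp (tendsto_dyadic_apply hω t k)
  refine tendsto_nhds_unique h1 ?_
  have heq : ∀ n, ω (dyadicFloor t n, -k) = EuclideanSpace.conjVec (ω (dyadicFloor t n, k)) :=
    fun n => hω.2.2.2.1 _ k
  simp_rw [heq]
  exact h2

/-- **Transversality of the extension**: `∑ⱼ kⱼ ω̄(t, k)ⱼ = 0`. -/
theorem sum_mul_pathExt_eq_zero {ω : Path d} (hω : ω ∈ pathSpace R L) (t : ℝ) (k : d → ℤ) :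
    ∑ j, (k j : ℂ) * pathExt ω t k j = 0 := by
  have hc : Continuous fun w : EuclideanSpace ℂ d => ∑ j, (k j : ℂ) * w j :=
    continuous_finsetSum _ fun j _ => continuous_const.mul (EuclideanSpace.proj j).continuous
  have h1 : Tendsto (fun n => ∑ j, (k j : ℂ) * ω (dyadicFloor t n, k) j) atTop
      (𝓝 (∑ j, (k j : ℂ) * pathExt ω t k j)) := (hc.tendsto _).comp (tendsto_dyadic_apply hω t k)
  have h2 : (fun n => ∑ j, (k j : ℂ) * ω (dyadicFloor t n, k) j) = fun _ => 0 :=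
    funext fun n => hω.2.2.2.2 _ k
  rw [h2] at h1
  exact tendsto_nhds_unique h1 tendsto_const_nhds

/-! ### The shift -/

/-- **The extension intertwines the shift**: `(θ^[i]ω)‾(t, k) = ω̄(t + i, k)` for `t ≥ 0`. -/
theorem pathExt_iterate_pathShift {ω : Path d} (hω : ω ∈ pathSpace R L) (i : ℕ) {t : ℝ} (ht : 0 ≤ t)
    (k : d → ℤ) : pathExt (pathShift^[i] ω) t k = pathExt ω (t + i) k := by
  have hωi : pathShift^[i] ω ∈ pathSpace R L := by
    induction i with
    | zero => simpa using hω
    | succ i ih => rw [iterate_succ_apply']; exact pathShift_mem ih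
  have h1 := tendsto_dyadic_apply hωi t k
  have heq : ∀ n, (pathShift^[i] ω) (dyadicFloor t n, k) = ω (dyadicFloor t n + i, k) := by
    intro n
    rw [pathShift_iterate_apply hω.1, max_eq_left (dyadicFloor_nonneg t n)]
  simp_rw [heq] at h1
  have h2 : Tendsto (fun n => ω (dyadicFloor t n + i, k)) atTop (𝓝 (pathExt ω (t + i) k)) := by
    refine tendsto_apply_of_tendsto hω (t + i) k (fun n => ?_) ?_
    · have := dyadicFloor_nonneg t n; positivity
    · have hmax : max (t + i) 0 = max t 0 + i := by
        rw [max_eq_left (by positivity), max_eq_left ht]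
      rw [hmax]
      simpa using (tendsto_dyadicFloor t).add_const (i : ℝ)
  exact tendsto_nhds_unique h1 h2

/-- The case `i = 1`: `(θω)‾(t, k) = ω̄(t + 1, k)` for `t ≥ 0`. -/
theorem pathExt_pathShift {ω : Path d} (hω : ω ∈ pathSpace R L) {t : ℝ} (ht : 0 ≤ t) (k : d → ℤ) :
    pathExt (pathShift ω) t k = pathExt ω (t + 1) k := by
  simpa using pathExt_iterate_pathShift hω 1 ht k

end Summit.AnomalousDissipation.AnomalousDissipation.Theorems.MomentParity
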